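import Mathlib
import Summits.Ventures.PercRepro2.Defs
import Summits.Ventures.PercRepro2.Harris
import Summits.Ventures.PercRepro2.Graph
import Summits.Ventures.PercRepro2.Events
import Summits.Ventures.PercRepro2.PsiPinInduction
import Summits.Ventures.PercRepro2.PsiUniSure
import Summits.Ventures.PercRepro2.PsiUniExplored
import Summits.Ventures.PercRepro2.PsiTEdge
import Summits.Ventures.PercRepro2.R21PinInduction
import Summits.Ventures.PercRepro2.R21OEdgeSGraph
import Summits.Ventures.PercRepro2.R21OEdgeY

/-!
# The edge to `y` of the `o`-exploration for the boundary derivative `R⁺` (PercRepro2, p2)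

For the pair frame `r21_pair_nonneg_of_uni_o` the `y`-edge must be good for BOTH slacks.  For
`R⁺ = R + D_y` this is automatic: two edges from the explored `o`-component to `y` are interchangeable
(each merges the `o`-cluster with the `y`-cluster), so along a `y`-edge `g` the slack `R⁺` is LINEAR,
`R⁺(p) = (1 − p g)·R⁺(p[g↦0])`: in the open world the seven masses of `D_y` all vanish
(`yEdge_dy_transfer`), whence `R⁺(p[g↦1]) = 0` and `T⁺_g = R⁺(p[g↦0])`, and
`2·min(R⁺(p[g↦0]), R⁺(p[g↦1])) ≤ T⁺_g` holds as soon as `0 ≤ R⁺(p[g↦0])` — the induction hypothesis.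

* `conn_update_true_y_u_iff`, `conn_update_true_o_u_iff` — `y ↔ u` and `o ↔ u` in the open world;
* `yEdge_dy_transfer` — the seven `D_y`-masses of the open world vanish;
* `rplus_uni_o_edge_y` — **the `y`-edge case of (UNI-R⁺_o)**, given `0 ≤ R⁺(p[f↦0])`.
-/

namespace Summit.Ventures.PercRepro2

section YEdgePlusGraph

variable {V : Type*} {E : Type*} [DecidableEq E] {R : Type*} [CommRing R] [LinearOrder R]

/-- With `f = {x, y}` open and `x` in the explored `o`-component, `y ↔ u` iff `y ↔ u` or `o ↔ u` in
the closed world. -/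
lemma conn_update_true_y_u_iff {ends : E → Sym2 V} {p : E → R} {ω : Config E} {f : E} {x o y u : V}
    (hf : ends f = s(x, y)) (hx : Conn ends (fun e => decide (p e = 1)) o x)
    (hpf : p f ≠ 1) (h1 : ∀ e, e ≠ f → p e = 1 → ω e = true) :
    Conn ends (Function.update ω f true) y u ↔
      Conn ends (Function.update ω f false) y u ∨ Conn ends (Function.update ω f false) o u := by
  rw [conn_update_true_iff_or hf, conn_x_iff_o hx hpf h1]
  have hyx : Conn ends (Function.update ω f false) y x ↔ Conn ends (Function.update ω f false) y o :=
    ⟨fun h => conn_symm ((conn_x_iff_o hx hpf h1 y).1 (conn_symm h)),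
     fun h => conn_symm ((conn_x_iff_o hx hpf h1 y).2 (conn_symm h))⟩
  rw [hyx]
  constructor
  · rintro (h | ⟨_, h⟩ | ⟨_, h⟩)
    · exact Or.inl h
    · exact Or.inl h
    · exact Or.inr h
  · rintro (h | h)
    · exact Or.inl h
    · exact Or.inr (Or.inr ⟨conn_refl _ _ _, h⟩)

/-- With `f = {x, y}` open and `x` in the explored `o`-component, `o ↔ u` iff `o ↔ u` or `y ↔ u` in
the closed world. -/
lemma conn_update_true_o_u_iff {ends : E → Sym2 V} {p : E → R} {ω : Config E} {f : E} {x o y u : V}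
    (hf : ends f = s(x, y)) (hx : Conn ends (fun e => decide (p e = 1)) o x)
    (hpf : p f ≠ 1) (h1 : ∀ e, e ≠ f → p e = 1 → ω e = true) :
    Conn ends (Function.update ω f true) o u ↔
      Conn ends (Function.update ω f false) o u ∨ Conn ends (Function.update ω f false) y u := by
  rw [conn_update_true_iff_or hf, conn_x_iff_o hx hpf h1]
  have hox : Conn ends (Function.update ω f false) o x :=
    conn_symm ((conn_x_iff_o hx hpf h1 o).2 (conn_refl _ _ _))
  constructor
  · rintro (h | ⟨_, h⟩ | ⟨_, h⟩)
    · exact Or.inl h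
    · exact Or.inr h
    · exact Or.inl h
  · rintro (h | h)
    · exact Or.inl h
    · exact Or.inr (Or.inl ⟨hox, h⟩)

end YEdgePlusGraph

section YEdgePlusProb

variable {V : Type*} {E : Type*} [Fintype E] [DecidableEq E]
  {R : Type*} [CommRing R] [LinearOrder R] [IsStrictOrderedRing R]

omit [IsStrictOrderedRing R] in
/-- The seven `D_y`-masses of the open world `p[f↦1]` of a `y`-edge vanish. -/
lemma yEdge_dy_transfer (p : E → R) (ends : E → Sym2 V) (s y o u x : V) (f : E)
    (hf : ends f = s(x, y)) (hx : Conn ends (fun e => decide (p e = 1)) o x) (hpf : p f ≠ 1) :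
    prob (Function.update p f 1) ((connEvent ends s u)ᶜ ∩ connEvent ends s o ∩ connEvent ends y u) = 0 ∧
      prob (Function.update p f 1) ((connEvent ends s u)ᶜ ∩ connEvent ends s y ∩ connEvent ends o u) = 0 ∧
      prob (Function.update p f 1) ((connEvent ends s y)ᶜ ∩ (connEvent ends s o)ᶜ ∩ (connEvent ends y o)ᶜ) = 0 ∧
      prob (Function.update p f 1) (connEvent ends s o ∩ (connEvent ends s y)ᶜ) = 0 ∧
      prob (Function.update p f 1) ((connEvent ends s o)ᶜ ∩ connEvent ends s y ∩ connEvent ends s u) = 0 ∧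
      prob (Function.update p f 1) (connEvent ends s u ∩ connEvent ends s o ∩ (connEvent ends s y)ᶜ) = 0 ∧
      prob (Function.update p f 1) ((connEvent ends s o)ᶜ ∩ connEvent ends s y) = 0 := by
  have key : ∀ (A : Set (Config E)),
      (∀ ω : Config E, (∀ e, e ≠ f → p e = 1 → ω e = true) → Function.update ω f true ∉ A) →
      prob (Function.update p f 1) A = 0 := by
    intro A h
    refine (prob_update_one_eq_prob_update_zero_of_respects p f fun ω _ h1 =>
      (show Function.update ω f true ∈ A ↔ Function.update ω f false ∈ (∅ : Set (Config E)) from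
        ⟨fun hA => absurd hA (h ω h1), fun h' => absurd h' (Set.notMem_empty _)⟩)).trans (prob_empty _)
  have hsv : ∀ (ω : Config E), (∀ e, e ≠ f → p e = 1 → ω e = true) → ∀ v,
      Conn ends (Function.update ω f true) s v ↔
        Conn ends (Function.update ω f false) s v ∨
          (Conn ends (Function.update ω f false) s o ∧ Conn ends (Function.update ω f false) y v) ∨
          (Conn ends (Function.update ω f false) s y ∧ Conn ends (Function.update ω f false) o v) :=
    fun ω h1 v => conn_update_true_s_iff_y hf hx hpf h1 v
  have hyo : ∀ (ω : Config E), (∀ e, e ≠ f → p e = 1 → ω e = true) →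
      Conn ends (Function.update ω f true) y o := fun ω h1 => conn_update_true_y_o_of_x hf hx hpf h1
  have hyu : ∀ (ω : Config E), (∀ e, e ≠ f → p e = 1 → ω e = true) →
      (Conn ends (Function.update ω f true) y u ↔
        Conn ends (Function.update ω f false) y u ∨ Conn ends (Function.update ω f false) o u) :=
    fun ω h1 => conn_update_true_y_u_iff hf hx hpf h1
  have hou : ∀ (ω : Config E), (∀ e, e ≠ f → p e = 1 → ω e = true) →
      (Conn ends (Function.update ω f true) o u ↔
        Conn ends (Function.update ω f false) o u ∨ Conn ends (Function.update ω f false) y u) :=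
    fun ω h1 => conn_update_true_o_u_iff hf hx hpf h1
  refine ⟨?_, ?_, ?_, ?_, ?_, ?_, ?_⟩
  · -- `aᶜ ∩ h ∩ Y_u`: on `h` (resp. `S`) the open `a` holds
    refine key _ fun ω h1 => ?_
    simp only [Set.mem_inter_iff, Set.mem_compl_iff, mem_connEvent, hsv ω h1 u, hsv ω h1 o,
      hyu ω h1]
    rintro ⟨⟨hna, hh⟩, hyu'⟩
    rcases hh with hso | ⟨hso, _⟩ | ⟨hsy, _⟩
    · rcases hyu' with hyu' | hou'
      · exact hna (Or.inr (Or.inl ⟨hso, hyu'⟩))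
      · exact hna (Or.inl (conn_trans hso hou'))
    · rcases hyu' with hyu' | hou'
      · exact hna (Or.inr (Or.inl ⟨hso, hyu'⟩))
      · exact hna (Or.inl (conn_trans hso hou'))
    · rcases hyu' with hyu' | hou'
      · exact hna (Or.inl (conn_trans hsy hyu'))
      · exact hna (Or.inr (Or.inr ⟨hsy, hou'⟩))
  · -- `aᶜ ∩ S ∩ O_u`
    refine key _ fun ω h1 => ?_
    simp only [Set.mem_inter_iff, Set.mem_compl_iff, mem_connEvent, hsv ω h1 u, hsv ω h1 y,
      hou ω h1]
    rintro ⟨⟨hna, hS⟩, hou'⟩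
    rcases hS with hsy | ⟨hso, _⟩ | ⟨hsy, _⟩
    · rcases hou' with hou' | hyu'
      · exact hna (Or.inr (Or.inr ⟨hsy, hou'⟩))
      · exact hna (Or.inl (conn_trans hsy hyu'))
    · rcases hou' with hou' | hyu'
      · exact hna (Or.inl (conn_trans hso hou'))
      · exact hna (Or.inr (Or.inl ⟨hso, hyu'⟩))
    · rcases hou' with hou' | hyu'
      · exact hna (Or.inr (Or.inr ⟨hsy, hou'⟩))
      · exact hna (Or.inl (conn_trans hsy hyu'))
  · -- `𝟙 ∩ hᶜ ∩ ℓᶜ`: `ℓ` is sure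
    refine key _ fun ω h1 => ?_
    simp only [Set.mem_inter_iff, Set.mem_compl_iff, mem_connEvent, hyo ω h1, not_true_eq_false,
      and_false, not_false_eq_true]
  · -- `h ∩ 𝟙`: `h` forces `s ↔ y`
    refine key _ fun ω h1 => ?_
    simp only [Set.mem_inter_iff, Set.mem_compl_iff, mem_connEvent, hsv ω h1 o, hsv ω h1 y]
    rintro ⟨hh, hnS⟩
    rcases hh with hso | ⟨hso, _⟩ | ⟨hsy, _⟩
    · exact hnS (Or.inr (Or.inl ⟨hso, conn_refl _ _ _⟩))
    · exact hnS (Or.inr (Or.inl ⟨hso, conn_refl _ _ _⟩))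
    · exact hnS (Or.inl hsy)
  · -- `hᶜ ∩ S ∩ a`: `S` forces `h`
    refine key _ fun ω h1 => ?_
    simp only [Set.mem_inter_iff, Set.mem_compl_iff, mem_connEvent, hsv ω h1 o, hsv ω h1 y,
      hsv ω h1 u]
    rintro ⟨⟨hnh, hS⟩, _⟩
    rcases hS with hsy | ⟨hso, _⟩ | ⟨hsy, _⟩
    · exact hnh (Or.inr (Or.inr ⟨hsy, conn_refl _ _ _⟩))
    · exact hnh (Or.inl hso)
    · exact hnh (Or.inr (Or.inr ⟨hsy, conn_refl _ _ _⟩))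
  · -- `a ∩ h ∩ 𝟙`
    refine key _ fun ω h1 => ?_
    simp only [Set.mem_inter_iff, Set.mem_compl_iff, mem_connEvent, hsv ω h1 o, hsv ω h1 y,
      hsv ω h1 u]
    rintro ⟨⟨_, hh⟩, hnS⟩
    rcases hh with hso | ⟨hso, _⟩ | ⟨hsy, _⟩
    · exact hnS (Or.inr (Or.inl ⟨hso, conn_refl _ _ _⟩))
    · exact hnS (Or.inr (Or.inl ⟨hso, conn_refl _ _ _⟩))
    · exact hnS (Or.inl hsy)
  · -- `hᶜ ∩ S`
    refine key _ fun ω h1 => ?_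
    simp only [Set.mem_inter_iff, Set.mem_compl_iff, mem_connEvent, hsv ω h1 o, hsv ω h1 y]
    rintro ⟨hnh, hS⟩
    rcases hS with hsy | ⟨hso, _⟩ | ⟨hsy, _⟩
    · exact hnh (Or.inr (Or.inr ⟨hsy, conn_refl _ _ _⟩))
    · exact hnh (Or.inl hso)
    · exact hnh (Or.inr (Or.inr ⟨hsy, conn_refl _ _ _⟩))

/-- **The `y`-edge case of (UNI-R⁺_o).** For an unpinned edge `f = {x, y}` with `x` in the explored
`o`-component, `2·min(R⁺(p[f↦0]), R⁺(p[f↦1])) ≤ T⁺_f(p)` as soon as `0 ≤ R⁺(p[f↦0])`: in the open world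
`R⁺ = 0` and `T⁺_f = R⁺(p[f↦0])` identically. -/
theorem rplus_uni_o_edge_y (p : E → R) (ends : E → Sym2 V) (s y o u x : V) (f : E)
    (hf : ends f = s(x, y)) (hx : Conn ends (fun e => decide (p e = 1)) o x) (hpf : p f ≠ 1)
    (hplus : 0 ≤ (prob (Function.update p f 0) (connEvent ends s u ∩ clusterInEvent ends s {W : Set V | o ∈ W} ∩ (connEvent ends s y)ᶜ) + prob (Function.update p f 0) (connEvent ends s u ∩ connEvent ends y o ∩ (connEvent ends s y)ᶜ) + prob (Function.update p f 0) ((connEvent ends s y)ᶜ) * prob (Function.update p f 0) (connEvent ends s u ∩ clusterInEvent ends s {W : Set V | o ∈ W}) - (prob (Function.update p f 0) (connEvent ends s u ∩ (connEvent ends s y)ᶜ) * prob (Function.update p f 0) (clusterInEvent ends s {W : Set V | o ∈ W}) + prob (Function.update p f 0) (clusterInEvent ends s {W : Set V | o ∈ W} ∩ (connEvent ends s y)ᶜ) * prob (Function.update p f 0) (connEvent ends s u) + prob (Function.update p f 0) (connEvent ends y o ∩ (connEvent ends s y)ᶜ) * prob (Function.update p f 0) (connEvent ends s u))) + ((prob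 (Function.update p f 0) ((connEvent ends s u)ᶜ ∩ connEvent ends s o ∩ connEvent ends y u) + prob (Function.update p f 0) ((connEvent ends s u)ᶜ ∩ connEvent ends s y ∩ connEvent ends o u)) * prob (Function.update p f 0) ((connEvent ends s y)ᶜ ∩ (connEvent ends s o)ᶜ ∩ (connEvent ends y o)ᶜ) + prob (Function.update p f 0) (connEvent ends s o ∩ (connEvent ends s y)ᶜ) * prob (Function.update p f 0) ((connEvent ends s o)ᶜ ∩ connEvent ends s y ∩ connEvent ends s u) - prob (Function.update p f 0) (connEvent ends s u ∩ connEvent ends s o ∩ (connEvent ends s y)ᶜ) * prob (Function.update p f 0) ((connEvent ends s o)ᶜ ∩ connEvent ends s y))) :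
    2 * min ((prob (Function.update p f 0) (connEvent ends s u ∩ clusterInEvent ends s {W : Set V | o ∈ W} ∩ (connEvent ends s y)ᶜ) + prob (Function.update p f 0) (connEvent ends s u ∩ connEvent ends y o ∩ (connEvent ends s y)ᶜ) + prob (Function.update p f 0) ((connEvent ends s y)ᶜ) * prob (Function.update p f 0) (connEvent ends s u ∩ clusterInEvent ends s {W : Set V | o ∈ W}) - (prob (Function.update p f 0) (connEvent ends s u ∩ (connEvent ends s y)ᶜ) * prob (Function.update p f 0) (clusterInEvent ends s {W : Set V | o ∈ W}) + prob (Function.update p f 0) (clusterInEvent ends s {W : Set V | o ∈ W} ∩ (connEvent ends s y)ᶜ) * prob (Function.update p f 0) (connEvent ends s u) + prob (Function.update p f 0) (connEvent ends y o ∩ (connEvent ends s y)ᶜ) * prob (Function.update p f 0) (connEvent ends s u))) + ((prob (Function.update p f 0) ((connEvent ends s u)ᶜ ∩ connEvent ends s o ∩ connEvent ends y u) + prob (Function.update p f 0) ((connEvent ends s u)ᶜ ∩ connEvent ends s y ∩ connEvent ends o u)) * prob (Function.update p f 0) ((connEvent ends s y)ᶜ ∩ (connEvent ends s o)ᶜ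 ∩ (connEvent ends y o)ᶜ) + prob (Function.update p f 0) (connEvent ends s o ∩ (connEvent ends s y)ᶜ) * prob (Function.update p f 0) ((connEvent ends s o)ᶜ ∩ connEvent ends s y ∩ connEvent ends s u) - prob (Function.update p f 0) (connEvent ends s u ∩ connEvent ends s o ∩ (connEvent ends s y)ᶜ) * prob (Function.update p f 0) ((connEvent ends s o)ᶜ ∩ connEvent ends s y))) ((prob (Function.update p f 1) (connEvent ends s u ∩ clusterInEvent ends s {W : Set V | o ∈ W} ∩ (connEvent ends s y)ᶜ) + prob (Function.update p f 1) (connEvent ends s u ∩ connEvent ends y o ∩ (connEvent ends s y)ᶜ) + prob (Function.update p f 1) ((connEvent ends s y)ᶜ) * prob (Function.update p f 1) (connEvent ends s u ∩ clusterInEvent ends s {W : Set V | o ∈ W}) - (prob (Function.update p f 1) (connEvent ends s u ∩ (connEvent ends s y)ᶜ) * prob (Function.update p f 1) (clusterInEvent ends s {W : Set V | o ∈ W}) + prob (Function.update p f 1) (clusterInEvent ends s {W : Set V | o ∈ W} ∩ (connEvent ends s y)ᶜ) * prob (Function.update p f 1) (connEvent ends s u) + prob (Function.update p f 1) (connEvent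 ends y o ∩ (connEvent ends s y)ᶜ) * prob (Function.update p f 1) (connEvent ends s u))) + ((prob (Function.update p f 1) ((connEvent ends s u)ᶜ ∩ connEvent ends s o ∩ connEvent ends y u) + prob (Function.update p f 1) ((connEvent ends s u)ᶜ ∩ connEvent ends s y ∩ connEvent ends o u)) * prob (Function.update p f 1) ((connEvent ends s y)ᶜ ∩ (connEvent ends s o)ᶜ ∩ (connEvent ends y o)ᶜ) + prob (Function.update p f 1) (connEvent ends s o ∩ (connEvent ends s y)ᶜ) * prob (Function.update p f 1) ((connEvent ends s o)ᶜ ∩ connEvent ends s y ∩ connEvent ends s u) - prob (Function.update p f 1) (connEvent ends s u ∩ connEvent ends s o ∩ (connEvent ends s y)ᶜ) * prob (Function.update p f 1) ((connEvent ends s o)ᶜ ∩ connEvent ends s y))) ≤ (prob (Function.update p f 0) (connEvent ends s u ∩ clusterInEvent ends s {W : Set V | o ∈ W} ∩ (connEvent ends s y)ᶜ) + prob (Function.update p f 1) (connEvent ends s u ∩ clusterInEvent ends s {W : Set V | o ∈ W} ∩ (connEvent ends s y)ᶜ) + prob (Function.update p f 0) (connEvent ends s u ∩ connEvent ends y o ∩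 (connEvent ends s y)ᶜ) + prob (Function.update p f 1) (connEvent ends s u ∩ connEvent ends y o ∩ (connEvent ends s y)ᶜ) + prob (Function.update p f 0) ((connEvent ends s y)ᶜ) * prob (Function.update p f 1) (connEvent ends s u ∩ clusterInEvent ends s {W : Set V | o ∈ W}) + prob (Function.update p f 1) ((connEvent ends s y)ᶜ) * prob (Function.update p f 0) (connEvent ends s u ∩ clusterInEvent ends s {W : Set V | o ∈ W}) - (prob (Function.update p f 0) (connEvent ends s u ∩ (connEvent ends s y)ᶜ) * prob (Function.update p f 1) (clusterInEvent ends s {W : Set V | o ∈ W}) + prob (Function.update p f 1) (connEvent ends s u ∩ (connEvent ends s y)ᶜ) * prob (Function.update p f 0) (clusterInEvent ends s {W : Set V | o ∈ W}) + prob (Function.update p f 0) (clusterInEvent ends s {W : Set V | o ∈ W} ∩ (connEvent ends s y)ᶜ) * prob (Function.update p f 1) (connEvent ends s u) + prob (Function.update p f 1) (clusterInEvent ends s {W : Set V | o ∈ W} ∩ (connEvent ends s y)ᶜ) * prob (Function.update p f 0) (connEvent ends s u) + prob (Function.update p f 0) (connEvent ends y o ∩ (connEvent ends s y)ᶜ)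 * prob (Function.update p f 1) (connEvent ends s u) + prob (Function.update p f 1) (connEvent ends y o ∩ (connEvent ends s y)ᶜ) * prob (Function.update p f 0) (connEvent ends s u))) + (prob (Function.update p f 0) ((connEvent ends s u)ᶜ ∩ connEvent ends s o ∩ connEvent ends y u) * prob (Function.update p f 1) ((connEvent ends s y)ᶜ ∩ (connEvent ends s o)ᶜ ∩ (connEvent ends y o)ᶜ) + prob (Function.update p f 1) ((connEvent ends s u)ᶜ ∩ connEvent ends s o ∩ connEvent ends y u) * prob (Function.update p f 0) ((connEvent ends s y)ᶜ ∩ (connEvent ends s o)ᶜ ∩ (connEvent ends y o)ᶜ) + prob (Function.update p f 0) ((connEvent ends s u)ᶜ ∩ connEvent ends s y ∩ connEvent ends o u) * prob (Function.update p f 1) ((connEvent ends s y)ᶜ ∩ (connEvent ends s o)ᶜ ∩ (connEvent ends y o)ᶜ) + prob (Function.update p f 1) ((connEvent ends s u)ᶜ ∩ connEvent ends s y ∩ connEvent ends o u) * prob (Function.update p f 0) ((connEvent ends s y)ᶜ ∩ (connEvent ends s o)ᶜ ∩ (connEvent ends y o)ᶜ) + prob (Function.update p f 0) (connEvent ends s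 o ∩ (connEvent ends s y)ᶜ) * prob (Function.update p f 1) ((connEvent ends s o)ᶜ ∩ connEvent ends s y ∩ connEvent ends s u) + prob (Function.update p f 1) (connEvent ends s o ∩ (connEvent ends s y)ᶜ) * prob (Function.update p f 0) ((connEvent ends s o)ᶜ ∩ connEvent ends s y ∩ connEvent ends s u) - prob (Function.update p f 0) (connEvent ends s u ∩ connEvent ends s o ∩ (connEvent ends s y)ᶜ) * prob (Function.update p f 1) ((connEvent ends s o)ᶜ ∩ connEvent ends s y) - prob (Function.update p f 1) (connEvent ends s u ∩ connEvent ends s o ∩ (connEvent ends s y)ᶜ) * prob (Function.update p f 0) ((connEvent ends s o)ᶜ ∩ connEvent ends s y)) := by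
  obtain ⟨t1, t2, t3, t4, t5, t6, t7, t8, t9⟩ := yEdge_transfer p ends s y o u x f hf hx hpf
  obtain ⟨z1, z2, z3, z4, z5, z6, z7⟩ := yEdge_dy_transfer p ends s y o u x f hf hx hpf
  obtain ⟨m1, m2, m3, m4, m5, m6, m7, m8⟩ := yEdge_masses (Function.update p f 0) ends s y o u
  have hh : clusterInEvent ends s {W : Set V | o ∈ W} = connEvent ends s o :=
    clusterInEvent_mem_eq_connEvent_ycl ends s o
  rw [hh] at t1 t4 t6 t7 hplus ⊢
  rw [t1, t2, t3, t4, t5, t6, t7, t8, t9, z1, z2, z3, z5, z7, m1, m2, m3]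
  rw [m4, m5] at hplus ⊢
  rw [m6, m7, m8] at hplus ⊢
  refine two_mul_min_le_of_plus ?_ ?_ (by rw [add_zero]; exact hplus)
  · ring
  · ring

end YEdgePlusProb

end Summit.Ventures.PercRepro2
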